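import Summits.QuantumFields.QCD.Theses.PauliWegnerSea

/-!
# `ChiralGluonicCompletion` (crux stmt-QuantumFields-17498) — negative-side support: the shape of the pin
# `reg.IsChiralAtZero` (one gapless tuple anywhere suffices; chirality BY BLOW-UP; what the gap clause forces)

Definition-free extract of the standing disprover's `Cruxes/ChiralGluonicCompletion/Disproof.lean` §5
(cdisprove gen 1). The pin `∀ ε > 0, ∃ m > 0, ¬ (reg.scheme m 0 0).HasLatticeMassGap ε` is the one hypothesis of
the crux that is new relative to the sibling `GluonicCompletion`; these lemmas record what it does and does not say:
* `isChiralAtZero_of_gaplessPoint` — ONE positive mass tuple (however heavy or split) without a uniform lattice gap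
  at any rate already gives the pin: the typed clause does not force `m → 0⁺`;
* `not_hasLatticeMassGap_of_blowup`, `isChiralAtZero_of_blowup` — an UNBOUNDED signed connected correlator along
  the admissible tori (a sign pathology of the `(−1)^F`-twisted functional `qcdTorusExpect` on tori `S > L_k`, where
  the crux's clause (iv) says nothing) gives the pin with no light pion anywhere ("chiral by blow-up");
* `no_sameReg_latticeGap_of_blowup` — at such a tuple NO species renormalisation yields the conclusion's lattice
  gap for the same regularisation: a keep-`reg` completion must first prove volume-uniform BOUNDEDNESS of all
  signed connected correlators at every `m > 0` on all `S ≥ L_k` (`bounded_of_hasLatticeMassGap`: the gap clause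
  implies it), which sign coherence at the single side `S = L_k` plus phase-quenched decay do not supply;
* `isChiralAtZero_of_uniform` — the Goldstone reading (ALL light enough tuples gapless at rate `ε`) implies the
  typed pin; the converse fails as typed, so the crux's hypothesis is weaker than "Goldstone along the trajectory".
-/

noncomputable section

namespace Summit.QuantumFields.QCD.Theorems.ChiralGluonicCompletion.Negative

open Filter Literature.MathematicalPhysics.QuantumFieldTheory

variable {Nf : ℕ}

/-- **One gapless mass tuple anywhere gives the pin.** [folklore] -/
theorem isChiralAtZero_of_gaplessPoint (reg : QCDRegularisation Nf)
    (h : ∃ m : Fin Nf → ℝ, (∀ f, 0 < m f) ∧ ∀ ε > (0 : ℝ), ¬ (reg.scheme m 0 0).HasLatticeMassGap ε) :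
    reg.IsChiralAtZero := by
  obtain ⟨m, hm, h⟩ := h
  exact fun ε hε => ⟨m, hm, h ε hε⟩

/-- The conclusion's gap clause forces BOUNDEDNESS: under `HasLatticeMassGap Δ` (`Δ ≥ 0`) every pair of local
observables has volume-uniformly bounded connected correlators, eventually in `k`, on ALL tori `S ≥ L_k`. [folklore] -/
theorem bounded_of_hasLatticeMassGap (sch : QCDScheme Nf) {Δ : ℝ} (hΔ : 0 ≤ Δ) (h : sch.HasLatticeMassGap Δ)
    {R R' : ℕ} (A : QCDLatticeObservable Nf R) (B : QCDLatticeObservable Nf R') :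
    ∃ C : ℝ, ∀ᶠ k in atTop, ∀ S : ℕ, sch.L k ≤ S → ∀ n : ℕ, n ≤ S →
      ‖qcdLatticeConnectedCorr (sch.β k) (2 * S + 1) (fun fl => sch.mq fl k) A B n‖ ≤ C := by
  obtain ⟨C, hC⟩ := h R R' A B
  refine ⟨max C 0, ?_⟩
  filter_upwards [hC] with k hk S hS n hn
  refine (hk S hS n hn).trans ?_
  have han : 0 ≤ sch.a k * n := mul_nonneg (sch.a_pos k).le (Nat.cast_nonneg n)
  have hexp : Real.exp (-(Δ * (sch.a k * n))) ≤ 1 :=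
    Real.exp_le_one_iff.2 (neg_nonpos.2 (mul_nonneg hΔ han))
  calc C * Real.exp (-(Δ * (sch.a k * n)))
      ≤ max C 0 * Real.exp (-(Δ * (sch.a k * n))) :=
        mul_le_mul_of_nonneg_right (le_max_left _ _) (Real.exp_pos _).le
    _ ≤ max C 0 * 1 := mul_le_mul_of_nonneg_left hexp (le_max_right _ _)
    _ = max C 0 := mul_one _

/-- **A blow-up point has no uniform lattice gap at any non-negative rate** (for any species renormalisations): if
some connected correlator of the honest lattice theory of `reg` at masses `m` exceeds every constant frequently in
`k` on some admissible torus, `HasLatticeMassGap Δ` fails for every `Δ ≥ 0`. [folklore] -/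
theorem not_hasLatticeMassGap_of_blowup (reg : QCDRegularisation Nf) (m : Fin Nf → ℝ)
    (h : ∃ (R R' : ℕ) (A : QCDLatticeObservable Nf R) (B : QCDLatticeObservable Nf R'), ∀ C : ℝ, ∃ᶠ k in atTop,
      ∃ S : ℕ, reg.L k ≤ S ∧ ∃ n : ℕ, n ≤ S ∧
        C < ‖qcdLatticeConnectedCorr (reg.β k) (2 * S + 1) (fun fl => reg.mcrit k + reg.a k * m fl / reg.Zm k) A B n‖)
    {Δ : ℝ} (hΔ : 0 ≤ Δ) (z shift : QCDField Nf → ℕ → ℝ) : ¬ (reg.scheme m z shift).HasLatticeMassGap Δ := by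
  obtain ⟨R, R', A, B, hAB⟩ := h
  intro hgap
  obtain ⟨C, hC⟩ := bounded_of_hasLatticeMassGap _ hΔ hgap A B
  obtain ⟨k, ⟨S, hS, n, hn, hlt⟩, hk⟩ := ((hAB C).and_eventually hC).exists
  exact absurd (hk S hS n hn) (not_le.2 hlt)

/-- **Chirality BY BLOW-UP**: a single blow-up point at positive masses makes `reg` chiral at zero — with no light
pion anywhere. As typed, the pin certifies "gapless OR sign-singular at some positive tuple". [folklore] -/
theorem isChiralAtZero_of_blowup (reg : QCDRegularisation Nf) (m : Fin Nf → ℝ) (hm : ∀ f, 0 < m f)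
    (h : ∃ (R R' : ℕ) (A : QCDLatticeObservable Nf R) (B : QCDLatticeObservable Nf R'), ∀ C : ℝ, ∃ᶠ k in atTop,
      ∃ S : ℕ, reg.L k ≤ S ∧ ∃ n : ℕ, n ≤ S ∧
        C < ‖qcdLatticeConnectedCorr (reg.β k) (2 * S + 1) (fun fl => reg.mcrit k + reg.a k * m fl / reg.Zm k) A B n‖) :
    reg.IsChiralAtZero :=
  isChiralAtZero_of_gaplessPoint reg ⟨m, hm, fun _ hε => not_hasLatticeMassGap_of_blowup reg m h hε.le 0 0⟩

/-- **… and then keep-`reg` is impossible**: at a blow-up point no species renormalisation gives the conclusion's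
lattice gap clause for the same regularisation. [folklore] -/
theorem no_sameReg_latticeGap_of_blowup (reg : QCDRegularisation Nf) (m : Fin Nf → ℝ)
    (h : ∃ (R R' : ℕ) (A : QCDLatticeObservable Nf R) (B : QCDLatticeObservable Nf R'), ∀ C : ℝ, ∃ᶠ k in atTop,
      ∃ S : ℕ, reg.L k ≤ S ∧ ∃ n : ℕ, n ≤ S ∧
        C < ‖qcdLatticeConnectedCorr (reg.β k) (2 * S + 1) (fun fl => reg.mcrit k + reg.a k * m fl / reg.Zm k) A B n‖) :
    ¬ ∃ (z shift : QCDField Nf → ℕ → ℝ), ∃ Δ > (0 : ℝ), (reg.scheme m z shift).HasLatticeMassGap Δ := by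
  rintro ⟨z, shift, Δ, hΔ, hgap⟩
  exact not_hasLatticeMassGap_of_blowup reg m h hΔ.le z shift hgap

/-- **Uniform (Goldstone-type) chirality implies the typed pin**, which asks for one tuple per rate only. [folklore] -/
theorem isChiralAtZero_of_uniform (reg : QCDRegularisation Nf)
    (h : ∀ ε > (0 : ℝ), ∃ δ > (0 : ℝ), ∀ m : Fin Nf → ℝ, (∀ f, 0 < m f ∧ m f < δ) →
      ¬ (reg.scheme m 0 0).HasLatticeMassGap ε) :
    reg.IsChiralAtZero := by
  intro ε hε
  obtain ⟨δ, hδ, hm⟩ := h ε hε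
  exact ⟨fun _ => δ / 2, fun _ => by linarith, hm _ fun _ => ⟨by linarith, by linarith⟩⟩

end Summit.QuantumFields.QCD.Theorems.ChiralGluonicCompletion.Negative

end
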